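import Literature.NumberTheory.EllipticCurves.Rank1Residual.FirstLayerCertificates
import Literature.NumberTheory.EllipticCurves.Sha
import HarnessLib

/-!
# RANK-ONE ANCHOR DATA at a pair `(E, p)`: the layer-`0` fine Mordell–Weil certificate for statement (A)
# of Coates–Sujatha, in the two spellings of its local sockets (torsion / Tamagawa) — definitions only

Topic `NumberTheory/EllipticCurves/Rank1Residual` (namespace = path).  Cell `bsd-f3-mu` (D-0131 (3)), planner
of record `-imc` gen 4 for the typer; transcription of the `-desc` lens's generation-3 «fine Mordell–Weil
certificate» (HOME/MEMO-desc.md §11, desc/Sketch4.lean e481a5934f0b7626; refuter `-ref1` g4: THEOREM-GRADE;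
refuter `-ref2` g5 M23: statement = Ray–Sujatha, *Res. Number Theory* 9 (2023) Cor. 2.7 (tree fact `RaySujatha2023.cor27_…`, in flight), node print-assembled from
Greenberg LNM 1716 §3) in the KERNEL currency — i.e. EXACTLY the binders of the landed control theorems
`Summit.….Theorems.FineSelmerControl.conjA_rat_of_rankOne` (torsion sockets) and
`….conjA_of_fineMordellWeil_of_local` (classical socket at `v ∤ p`, fed by `p ∤ c_v` through the tree's sharp
Tamagawa bound `Summit.….Rank1Residual.Iwasawa.natCard_localTowerKerPrimary_zero_le_pow_padicValNat_localTamagawaNumber`).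
PREDICATES on pairs; nothing is asserted about any pair; no named fact.  Per pair they are DISPLAYED from record
data (Cremona generators and local data, Heegner index + Matar–Nekovář for `Ш[p^∞] = 0`); census: 217 / 234
rank-one X9 records (HOME/desc/d10/FMW-CERT-v2.tsv 9ca5fa31d4fdb843).  The glue «anchor data ⟹ (A) ⟹ Kato's
integral divisibility at the pair» is Summits-side (`Theorems/OneSidedTwistSqueezeX9FMWRung.lean`).

* `RankOneAnchorDataAt W p` — `S ⊇ {p} ∪ bad`, `v₀ ∣ p`, `#Ш(E/ℚ)[p^∞] = 1`, `E(ℚ) = ℤ·P + T` (`m·T = 0`,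
  `p ∤ m`), `P` with no `D_{v₀}`-fixed `p`-th root in `E(ℚ̄)` (`P ∉ p·E(ℚ_p)`), torsion sockets
  `E[p^∞]^{D_v}[p] = 0` for every `v ∈ S`;
* `RankOneAnchorDataTamAt W p` — the same with the torsion socket only at `v₀` and `v ∤ p ∧ p ∤ c_v(E/ℚ_v)` at
  the other places of `S` (Greenberg's `#ker r_v = c_v^{(p)}`).

References: [GreenbergLNM1716] §2 (Kummer sequence), §3 (after Lemma 3.3), Prop. 3.8 and Remark;
[CoatesSujatha2005] §3 (statement (A)); [RaySujatha2021] Cor. 2.7 (Res. Number Theory 9 (2023)); HOME MEMO-desc.md §11, MEMO-imc.md §12.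
-/

noncomputable section

open scoped Classical

open WeierstrassCurve Literature.NumberTheory.EllipticCurves IsDedekindDomain NumberField

namespace Literature.NumberTheory.EllipticCurves.Rank1Residual

/-- **`RankOneAnchorDataAt W p` — RANK-ONE ANCHOR DATA, torsion sockets** (the binders of
`FineSelmerControl.conjA_rat_of_rankOne`, verbatim): a finite set `S` of finite places of `ℚ` off which `E` is
good and `v ∤ p`; a place `v₀ ∈ S` above `p`; `#Ш(E/ℚ)[p^∞] = 1`; a rational point `P` and `m` with `p ∤ m`
such that every rational point is `n•P + T` with `m•T = 0` (rank one up to prime-to-`p` torsion); `P` has no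
`D_{v₀}`-fixed `p`-th root among the geometric points (`P ∉ p·E(ℚ_{v₀})`); and for every `v ∈ S` no non-zero
`D_v`-fixed `p`-torsion point of `E[p^∞]` (`E(ℚ_v)[p] = 0`: non-anomalous at `p`, (c3)-clean at the bad
places).  A predicate, displayed per pair from records; Greenberg's Prop. 3.8 data in the rank-one form.
[cite: GreenbergLNM1716, Prop. 3.8 (book:coates1999 chunk p0095) and §2 (Kummer sequence)] -/
def RankOneAnchorDataAt (W : WeierstrassCurve ℚ) [W.IsElliptic] (p : ℕ) [Fact p.Prime] : Prop :=
  ∃ (S : Finset (HeightOneSpectrum (𝓞 ℚ))) (v₀ : HeightOneSpectrum (𝓞 ℚ)) (P : W.toAffine.Point) (m : ℕ),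
    (∀ v ∉ S, ((p : ℕ) : 𝓞 ℚ) ∉ v.asIdeal ∧ W.HasGoodReductionAt v) ∧ v₀ ∈ S ∧
    ((p : ℕ) : 𝓞 ℚ) ∈ v₀.asIdeal ∧ Nat.card (AddCommGroup.primaryComponent W.sha p) = 1 ∧ ¬ p ∣ m ∧
    (letI := Classical.decEq ℚ
     ∀ R : W.toAffine.Point, ∃ (n : ℤ) (T : W.toAffine.Point), m • T = 0 ∧ R = n • P + T) ∧
    (∀ Q : WeierstrassCurve.geomPoints W, (∀ d ∈ GreenbergSelmer.decomp v₀, d • Q = Q) →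
      p • Q ≠ WeierstrassCurve.toGeomPoints W P) ∧
    (∀ v ∈ S, ∀ x : W.geomPrimaryTorsion p, p • x = 0 → (∀ d ∈ GreenbergSelmer.decomp v, d • x = x) → x = 0)

/-- **`RankOneAnchorDataTamAt W p` — RANK-ONE ANCHOR DATA, Tamagawa spelling** (the census's `FMW_cert_v2`):
as `RankOneAnchorDataAt` but with the torsion socket required only at `v₀ ∣ p`, and at every other `v ∈ S` the
conditions `v ∤ p` and `p ∤ c_v`, `c_v` the local Tamagawa number of the base change of `W` to `ℚ_v` (so that
Greenberg's classical socket `ker r_v = 0` holds: `#ker r_v = c_v^{(p)}`).  A predicate, displayed per pair.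
[cite: GreenbergLNM1716, §3 (after Lemma 3.3: `|ker r_v| = c_v^{(p)}`, book:coates1999 chunk p0088) and Prop. 3.8 with its Remark (chunk p0095)] -/
def RankOneAnchorDataTamAt (W : WeierstrassCurve ℚ) [W.IsElliptic] (p : ℕ) [Fact p.Prime] : Prop :=
  ∃ (S : Finset (HeightOneSpectrum (𝓞 ℚ))) (v₀ : HeightOneSpectrum (𝓞 ℚ)) (P : W.toAffine.Point) (m : ℕ),
    (∀ v ∉ S, ((p : ℕ) : 𝓞 ℚ) ∉ v.asIdeal ∧ W.HasGoodReductionAt v) ∧ v₀ ∈ S ∧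
    ((p : ℕ) : 𝓞 ℚ) ∈ v₀.asIdeal ∧ Nat.card (AddCommGroup.primaryComponent W.sha p) = 1 ∧ ¬ p ∣ m ∧
    (letI := Classical.decEq ℚ
     ∀ R : W.toAffine.Point, ∃ (n : ℤ) (T : W.toAffine.Point), m • T = 0 ∧ R = n • P + T) ∧
    (∀ Q : WeierstrassCurve.geomPoints W, (∀ d ∈ GreenbergSelmer.decomp v₀, d • Q = Q) →
      p • Q ≠ WeierstrassCurve.toGeomPoints W P) ∧
    (∀ x : W.geomPrimaryTorsion p, p • x = 0 → (∀ d ∈ GreenbergSelmer.decomp v₀, d • x = x) → x = 0) ∧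
    (∀ v ∈ S, v ≠ v₀ → ((p : ℕ) : 𝓞 ℚ) ∉ v.asIdeal ∧
      padicValNat p ((W.baseChange (v.adicCompletion ℚ)).localTamagawaNumber (v.adicCompletionIntegers ℚ)) = 0)

end Literature.NumberTheory.EllipticCurves.Rank1Residual

end
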